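import Mathlib
import HarnessLib
import Literature.MathematicalPhysics.QuantumLattice.GaugeGroupsProofs

/-!
# `|tr U| ≤ 3` on `SU(3)` with equality exactly at the centre: the modulus of the normalised trace (plaquette, Polyakov loop) reaches `1` only for `U = ζ·1`, `ζ³ = 1`

HONEST FRAMING: exact (Metropolis-corrected) sampling algorithms for lattice gauge theory;
figures of merit are autocorrelation/cost numbers at stated couplings and volumes; no
continuum-physics claim.

Venture `LatticeQCDFlow` (cell pub-lqcd), sub-topic `Scoring`; FANOUT row 21 (`su3-base`: the 4D
`SU(3)` baselines).  NEW WORK of the cell (placement rule), elementary, over the Literature file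
`QuantumLattice/GaugeGroupsProofs` (`exists_conj_eq_diagonal`: the torus theorem, Bröcker–tom Dieck
IV (3.1); `diagonal_mem_specialUnitaryGroup_iff`); no definition is introduced; nothing is cited as a
fact; no number of ours.  Companion of `Scoring/SU3TraceLowerBound` (`Re tr U = 3 ⇔ U = 1`,
`Re tr U = −3/2 ⇔ U` a non-trivial centre element): here the MODULUS.

For unimodular `a, b`: `|a + b|² + |a − b|² = 4` (parallelogram law), so `|a + b| ≥ 2` forces
`a = b`.  Hence three unimodular numbers with `|a + b + c| ≥ 3` are all equal, and for `U ∈ SU(3)`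
(eigenvalues unimodular with product `1`): `|tr U| ≤ 3`, with equality iff the three eigenvalues
coincide, i.e. iff `U = ζ·1` with `ζ³ = 1` — the CENTRE `Z₃`.  The normalised trace `(1/3) tr U`
(the complex plaquette, or the Polyakov loop of a single holonomy) therefore has modulus `≤ 1` with
modulus `1` only on the three centre elements, where it takes the values `1, e^{±2πi/3}`.

## What is proved

* §1 `normSq_add_add_normSq_sub_of_unimodular` (`|a+b|² + |a−b|² = 4`),
  **`eq_of_two_le_norm_add`** (`|a + b| ≥ 2 ⟹ a = b`), `norm_add_add_le_three`,
  **`eq_of_three_le_norm_add_add`** (`|a + b + c| ≥ 3 ⟹ a = b ∧ a = c`).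
* §2 (`SU(3)`) **`su3_norm_trace_le`**
  (`|tr U| ≤ 3`), **`su3_norm_trace_eq_three_iff`** (`|tr U| = 3 ⇔ ∃ ζ, ζ³ = 1 ∧ U = ζ·1`),
  `su3_norm_trace_lt_three_of_not_central`, and the normalised forms `su3_norm_third_trace_le_one`,
  `su3_norm_third_trace_eq_one_iff`.

NOT CLAIMED: anything about the distribution of `|tr U_p|` or of the Polyakov loop under the Wilson
measure (centre-sector physics); anything for `N ≠ 3` (the same argument gives `|tr U| = N ⇔ U`
central for every `N`, not written out here).
-/

namespace Summit.Ventures.LatticeQCDFlow.Scoring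

open Matrix Complex
open Literature.MathematicalPhysics.QuantumLattice

/-! ## §1 Unimodular numbers whose sum has maximal modulus are equal -/

/-- Parallelogram law on the unit circle: `|a + b|² + |a − b|² = 4` for unimodular `a, b`. -/
theorem normSq_add_add_normSq_sub_of_unimodular {a b : ℂ} (ha : ‖a‖ = 1) (hb : ‖b‖ = 1) :
    ‖a + b‖ ^ 2 + ‖a - b‖ ^ 2 = 4 := by
  have ha2 : a.re * a.re + a.im * a.im = 1 := by
    have h := Complex.sq_norm a
    rw [ha, one_pow, Complex.normSq_apply] at h
    exact h.symm
  have hb2 : b.re * b.re + b.im * b.im = 1 := by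
    have h := Complex.sq_norm b
    rw [hb, one_pow, Complex.normSq_apply] at h
    exact h.symm
  rw [Complex.sq_norm, Complex.sq_norm, Complex.normSq_apply, Complex.normSq_apply]
  simp only [Complex.add_re, Complex.add_im, Complex.sub_re, Complex.sub_im]
  linear_combination 2 * ha2 + 2 * hb2

/-- **Two unimodular numbers with `|a + b| ≥ 2` are equal** (then `|a − b|² = 4 − |a + b|² ≤ 0`). -/
theorem eq_of_two_le_norm_add {a b : ℂ} (ha : ‖a‖ = 1) (hb : ‖b‖ = 1) (h : 2 ≤ ‖a + b‖) : a = b := by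
  have hp := normSq_add_add_normSq_sub_of_unimodular ha hb
  have h4 : 4 ≤ ‖a + b‖ ^ 2 := by nlinarith [norm_nonneg (a + b)]
  have h0 : ‖a - b‖ ^ 2 ≤ 0 := by linarith
  have h00 : ‖a - b‖ = 0 := by nlinarith [norm_nonneg (a - b), sq_nonneg ‖a - b‖]
  exact sub_eq_zero.mp (norm_eq_zero.mp h00)

/-- `|a + b + c| ≤ 3` for unimodular `a, b, c`. -/
theorem norm_add_add_le_three {a b c : ℂ} (ha : ‖a‖ = 1) (hb : ‖b‖ = 1) (hc : ‖c‖ = 1) :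
    ‖a + b + c‖ ≤ 3 := by
  calc ‖a + b + c‖ ≤ ‖a + b‖ + ‖c‖ := norm_add_le _ _
    _ ≤ (‖a‖ + ‖b‖) + ‖c‖ := by gcongr; exact norm_add_le _ _
    _ = 3 := by rw [ha, hb, hc]; norm_num

/-- **Three unimodular numbers with `|a + b + c| ≥ 3` are all equal.** -/
theorem eq_of_three_le_norm_add_add {a b c : ℂ} (ha : ‖a‖ = 1) (hb : ‖b‖ = 1) (hc : ‖c‖ = 1)
    (h : 3 ≤ ‖a + b + c‖) : a = b ∧ a = c := by
  have hab : 2 ≤ ‖a + b‖ := by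
    have h1 : ‖a + b + c‖ ≤ ‖a + b‖ + ‖c‖ := norm_add_le _ _
    rw [hc] at h1
    linarith
  have hac : 2 ≤ ‖a + c‖ := by
    have h1 : ‖a + c + b‖ ≤ ‖a + c‖ + ‖b‖ := norm_add_le _ _
    rw [hb, show a + c + b = a + b + c by ring] at h1
    linarith
  exact ⟨eq_of_two_le_norm_add ha hb hab, eq_of_two_le_norm_add ha hc hac⟩

/-! ## §2 `SU(3)`: `|tr U| ≤ 3`, with equality exactly at the centre -/

section SpecialUnitaryThree

/-- **`|tr U| ≤ 3` on `SU(3)`** (three unimodular eigenvalues). -/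
theorem su3_norm_trace_le (U : Matrix.specialUnitaryGroup (Fin 3) ℂ) :
    ‖(U : Matrix (Fin 3) (Fin 3) ℂ).trace‖ ≤ 3 := by
  obtain ⟨u, D, d, hD, hU⟩ := exists_conj_eq_diagonal U
  have h1 := norm_eq_one_of_coe_eq_diagonal hD
  have htr : (U : Matrix (Fin 3) (Fin 3) ℂ).trace = d 0 + d 1 + d 2 := by
    rw [hU]
    change ((u : Matrix (Fin 3) (Fin 3) ℂ) * (D : Matrix (Fin 3) (Fin 3) ℂ) *
        star (u : Matrix (Fin 3) (Fin 3) ℂ)).trace = _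
    rw [Matrix.trace_mul_cycle, Unitary.star_mul_self_of_mem u.2.1, Matrix.one_mul, hD,
      trace_diagonal, Fin.sum_univ_three]
  rw [htr]
  exact norm_add_add_le_three (h1 0) (h1 1) (h1 2)

/-- **`|tr U| = 3` on `SU(3)` iff `U` is central**: `U = ζ·1` with `ζ³ = 1` (the three eigenvalues
must coincide, and their product is `1`). -/
theorem su3_norm_trace_eq_three_iff (U : Matrix.specialUnitaryGroup (Fin 3) ℂ) :
    ‖(U : Matrix (Fin 3) (Fin 3) ℂ).trace‖ = 3 ↔
      ∃ ζ : ℂ, ζ ^ 3 = 1 ∧ (U : Matrix (Fin 3) (Fin 3) ℂ) = ζ • (1 : Matrix (Fin 3) (Fin 3) ℂ) := by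
  constructor
  · intro h
    obtain ⟨u, D, d, hD, hU⟩ := exists_conj_eq_diagonal U
    have h1 := norm_eq_one_of_coe_eq_diagonal hD
    have hp := prod_eq_one_of_coe_eq_diagonal hD
    rw [Fin.prod_univ_three] at hp
    have htr : (U : Matrix (Fin 3) (Fin 3) ℂ).trace = d 0 + d 1 + d 2 := by
      rw [hU]
      change ((u : Matrix (Fin 3) (Fin 3) ℂ) * (D : Matrix (Fin 3) (Fin 3) ℂ) *
          star (u : Matrix (Fin 3) (Fin 3) ℂ)).trace = _
      rw [Matrix.trace_mul_cycle, Unitary.star_mul_self_of_mem u.2.1, Matrix.one_mul, hD,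
        trace_diagonal, Fin.sum_univ_three]
    rw [htr] at h
    obtain ⟨h01, h02⟩ := eq_of_three_le_norm_add_add (h1 0) (h1 1) (h1 2) h.ge
    refine ⟨d 0, ?_, ?_⟩
    · calc d 0 ^ 3 = d 0 * d 1 * d 2 := by rw [← h01, ← h02]; ring
        _ = 1 := hp
    · have hd : d = fun _ => d 0 := by
        funext i
        fin_cases i
        · rfl
        · exact h01.symm
        · exact h02.symm
      have hDm : (D : Matrix (Fin 3) (Fin 3) ℂ) = d 0 • (1 : Matrix (Fin 3) (Fin 3) ℂ) := by
        rw [hD, hd, smul_one_eq_diagonal]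
      rw [hU]
      change (u : Matrix (Fin 3) (Fin 3) ℂ) * (D : Matrix (Fin 3) (Fin 3) ℂ) *
          star (u : Matrix (Fin 3) (Fin 3) ℂ) = _
      rw [hDm, Matrix.mul_smul, Matrix.mul_one, Matrix.smul_mul, Unitary.mul_star_self_of_mem u.2.1]
  · rintro ⟨ζ, h3, hU⟩
    have hn : ‖ζ‖ = 1 := by
      have h : ‖ζ‖ ^ 3 = 1 := by rw [← norm_pow, h3, norm_one]
      exact (pow_eq_one_iff_of_nonneg (norm_nonneg ζ) (by norm_num)).mp h
    rw [hU, Matrix.trace_smul, Matrix.trace_one, Fintype.card_fin, smul_eq_mul, norm_mul, hn]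
    simp

/-- Off the centre the trace modulus is STRICTLY below `3`. -/
theorem su3_norm_trace_lt_three_of_not_central (U : Matrix.specialUnitaryGroup (Fin 3) ℂ)
    (h : ¬ ∃ ζ : ℂ, ζ ^ 3 = 1 ∧ (U : Matrix (Fin 3) (Fin 3) ℂ) = ζ • (1 : Matrix (Fin 3) (Fin 3) ℂ)) :
    ‖(U : Matrix (Fin 3) (Fin 3) ℂ).trace‖ < 3 :=
  lt_of_le_of_ne (su3_norm_trace_le U) (fun h3 => h ((su3_norm_trace_eq_three_iff U).mp h3))

/-- The normalised trace (complex plaquette / one-holonomy Polyakov loop) has modulus `≤ 1`. -/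
theorem su3_norm_third_trace_le_one (U : Matrix.specialUnitaryGroup (Fin 3) ℂ) :
    ‖(1 / 3 : ℂ) * (U : Matrix (Fin 3) (Fin 3) ℂ).trace‖ ≤ 1 := by
  rw [norm_mul]
  have h := su3_norm_trace_le U
  have h3 : ‖(1 / 3 : ℂ)‖ = 1 / 3 := by simp
  rw [h3]
  linarith

/-- **The normalised trace has modulus `1` exactly on the centre `Z₃`.** -/
theorem su3_norm_third_trace_eq_one_iff (U : Matrix.specialUnitaryGroup (Fin 3) ℂ) :
    ‖(1 / 3 : ℂ) * (U : Matrix (Fin 3) (Fin 3) ℂ).trace‖ = 1 ↔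
      ∃ ζ : ℂ, ζ ^ 3 = 1 ∧ (U : Matrix (Fin 3) (Fin 3) ℂ) = ζ • (1 : Matrix (Fin 3) (Fin 3) ℂ) := by
  rw [← su3_norm_trace_eq_three_iff, norm_mul]
  have h3 : ‖(1 / 3 : ℂ)‖ = 1 / 3 := by simp
  rw [h3]
  constructor <;> intro h <;> linarith

end SpecialUnitaryThree

end Summit.Ventures.LatticeQCDFlow.Scoring
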